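import Summits.HodgeConjecture.HodgeConjecture.Theses.SparseFermatTropicalDeficiency
import Literature.AlgebraicGeometry.Motives.SmoothHypersurfaceExistenceProofs

/-!
# Birth skeleton (BC3) for the crux `TropicalShadowsCarryRank` (K2) of route
`SparseFermatTropicalDeficiency`

Crux (route decl, fixed; item `stmt-HodgeConjecture-18619`): for every sparse Fermat datum `𝔇` and
every generic unimodular height `h` there are coefficients `c` and a rank-one valuation `v` on `ℂ`,
trivial on `ℚ`, with `v(c_b) = e^{-h_b}` and `X_c` smooth projective, such that every family of
classes `x_a` supported on closed subsets `Z_a` of codimension `≥ p` has TROPICAL SHADOWS — tropical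
`p`-cycles adapted to a finite polyhedral structure `Q` of the extended tropical hypersurface `X̄_h`,
supported in `Trop_v(Z_a)` — whose classes in cellular tropical homology `H_{p,p}(X̄_h, Q; ℝ)` span at
least `cupRank` of the span of the invariant projections `π x_a`.

Line `birth` = the route's own two-layer plan K2a → K2b → K2c, cut at the seams the tree can type:

* K2a-i  `stub_heightValuation`   — ARITHMETIC OF HEIGHTS: algebraically independent coefficients
  `c_b` and a valuation `v` on `ℂ`, trivial on `ℚ×`, non-trivial, with `v(c_b) = e^{-h_b}` (monomial
  order valuation on `ℚ(T)`, `T ⊇ {c_b}` a transcendence basis, extended to `ℂ = ℚ(T)^alg`;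
  Chevalley). [MaclaganSturmfels2015 §2.1; Bourbaki AC VI §3]
* K2a-ii `stub_genericNonsingular` — the perturbed Fermat form with algebraically independent
  coefficients is a NONSINGULAR form, irreducible over every overfield (the singular locus in
  coefficient space is `ℚ`-closed and misses `c = 0`); the tree's Jacobian bridge
  `Motives.SmoothHypersurface.isSmoothHypersurface_hypersurface` then gives `X_c` smooth projective of
  dimension `2p` (homogeneity of the form is proved here: `form_isHomogeneous`). [Hartshorne I Ex. 5.8]
* K2a-iii `stub_kapranov` — KAPRANOV over the non-discretely valued `ℂ`: the extended tropicalisation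
  of `X_c` is the extended tropical hypersurface `X̄_h` (heights = valuations of the coefficients;
  closure = density of the divisible value group). [MaclaganSturmfels2015 Thm. 3.1.3/3.2.3, §6.2]
* K2b `stub_polyhedralShadows` — BIERI–GROVES / STRUCTURE THEOREM + common refinement: for finitely
  many Zariski-closed `W_j ⊆ X_c` there is ONE finite polyhedral structure `Q` of `X̄_h` in which every
  `Trop_v(W_j)` is a union of closed cells. [MaclaganSturmfels2015 Thm. 3.3.5, §6.2;
  AminiPiquerez2020TropicalHC §2]
* K2c `stub_classTransfer` — THE HEART (load-bearing, XL): for a finite family of IRREDUCIBLE closed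
  `W_j` of codimension `≥ p` with classes `y_j` dying off `W_j`, and such a `Q`, there are `Q`-adapted
  tropical `p`-cycles supported in the `Trop_v(W_j)` whose classes span `≥ cupRank (span π y_j)`
  (multiplicity-weighted shadows are balanced, Mikhalkin–Zharkov Prop. 4.3; the cycle-class /
  intersection comparison over a non-discrete valuation, Liu arXiv:1702.00047, IKMZ arXiv:1604.01838,
  is the open content named in the crux's "why it might fail").
* glue `stub_primeReduction` — FINITE PRIME FAMILIES SUFFICE: a class dying off a closed `Z` of
  codimension `≥ p` is a finite sum of classes dying off irreducible closed `W ⊆ Z` (the tree's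
  `mem_iSup_ker_restrictCompl_irreducible`, Deligne Hodge III Cor. 8.2.8), `H^{2p}(X_c(ℂ); ℂ)` is
  finite-dimensional (`finite_complexBetti`), `cupRank` is monotone in the subspace and `Trop_v` is
  monotone in the subset. [Fulton1998 §19.1; DeligneHodgeIII1974 Cor. 8.2.8]

Composition (sorry-free, kernel-checked): `TropicalShadowsCarryRank_of_pieces : HeightValuation →
GenericNonsingular → KapranovOnto → PolyhedralShadows → ClassTransfer → PrimeReduction → <the crux
statement, verbatim>`, and the skeleton theorem `TropicalShadowsCarryRank_of : TropicalShadowsCarryRank`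
(the route decl BY NAME) discharging the six hypotheses with the declared stubs — the only `sorry`s of
the file. BC3 probes (`stub statement → TropicalShadowsCarryRank`, `→ HodgeConjecture`,
`→ ¬HodgeConjecture` by `first | exact? | simpa | aesop`, definitions only in scope) all fail: see the
probe files of the registering seat (`bc/probe_*.lean`).
-/

noncomputable section

namespace Summit.HodgeConjecture.HodgeConjecture.Cruxes.TropicalShadowsCarryRank.Birth

open Literature.AlgebraicGeometry Literature.AlgebraicGeometry.HodgeTheory
  Literature.AlgebraicGeometry.Tropical Literature.AlgebraicGeometry.HodgeTheory.SparseFermat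

/-! ### Vocabulary -/

/-- The inner conclusion of the crux for ONE supported family `(Z_a, x_a)_{a ∈ ι}` on the realisation
`(c, v)` at heights `h`: a finite polyhedral structure `Q` of `X̄_h` and `Q`-adapted tropical
`p`-cycles `C_k`, supported in `Trop_v(Z_{f k})`, whose classes span at least `cupRank (span π x)`
(verbatim the tail of the route decl). -/
def ShadowsCarry (𝔇 : Datum) (h : ↥𝔇.B → ℝ) (c : ↥𝔇.B → ℂ) (v : Valuation ℂ NNReal)
    (ι : Type) (Z : ι → Set ↥(𝔇.variety c).left)
    (x : ι → complexBetti (𝔇.variety c) (2 * 𝔇.p)) : Prop :=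
  ∃ Q : Finset (TropCell (2 * 𝔇.p + 2)), IsStructureOf Q (𝔇.tropicalVariety h) ∧
    ∃ (κ : Type) (f : κ → ι) (C : κ → TropCycle Q 𝔇.p),
      (∀ k, (C k).support ⊆ 𝔇.tropicalization c v (Z (f k))) ∧
      cupRank (𝔇.variety c) (2 * 𝔇.p) (Submodule.span ℂ (Set.range fun a ↦ 𝔇.proj c (x a))) ≤
        Module.finrank ℝ ↥(Submodule.span ℝ (Set.range fun k ↦ (C k).cls))

/-- `Trop_v(W_j)` is a subcomplex of `Q`: a union of closed cells of `Q`. -/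
def IsSubcomplexFamily (𝔇 : Datum) (c : ↥𝔇.B → ℂ) (v : Valuation ℂ NNReal)
    (Q : Finset (TropCell (2 * 𝔇.p + 2))) {m : ℕ} (W : Fin m → Set ↥(𝔇.variety c).left) : Prop :=
  ∀ j, ∃ S : Finset (TropCell (2 * 𝔇.p + 2)), S ⊆ Q ∧
    𝔇.tropicalization c v (W j) = ⋃ σ ∈ S, closure σ.pts

/-! ### Stub statements (named `Prop`s) -/

/-- (K2a-i, L) ARITHMETIC OF HEIGHTS. For every datum and every height vector `h` there are
ALGEBRAICALLY INDEPENDENT coefficients `c_b ∈ ℂ` and a rank-one valuation `v : ℂ → ℝ_{≥0}`, trivial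
on `ℚ×`, non-trivial on `ℂ`, with `v(c_b) = e^{-h_b}`: the monomial-order valuation
`ord_w(Σ a_α T^α) = min ⟨α, w⟩` on `ℚ(T)` for a transcendence basis `T ⊇ {c_b} ∪ {t₀}` of `ℂ/ℚ`
(weights `w(c_b) = h_b`, `w(t₀) = 1`, `0` elsewhere), extended to the algebraic extension
`ℂ/ℚ(T)` (Chevalley; the value group stays in the divisible hull, inside `ℝ_{>0}`). No genericity
of `h` is needed. -/
def HeightValuation : Prop :=
  ∀ (𝔇 : Datum) (h : ↥𝔇.B → ℝ),
    ∃ (c : ↥𝔇.B → ℂ) (v : Valuation ℂ NNReal),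
      AlgebraicIndependent ℚ c ∧ (∀ q : ℚ, q ≠ 0 → v (q : ℂ) = 1) ∧
        (∀ b, ((v (c b) : NNReal) : ℝ) = Real.exp (-h b)) ∧ ∃ z : ℂ, 1 < v z

/-- (K2a-ii, M) GENERIC MEMBERS ARE NONSINGULAR. For algebraically independent coefficients the
perturbed Fermat form `Σ xᵢᵈ + Σ c_b x^b` is a nonsingular form (Jacobian criterion, the tree's
`IsNonsingularForm`) and irreducible over every overfield of `ℂ`: the locus of singular members is a
`ℚ`-closed subset of coefficient space (elimination) not containing the Fermat point `c = 0`
(`isNonsingularForm_sum_X_pow`), so it contains no algebraically independent point; a nonsingular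
form in `≥ 3` variables is geometrically irreducible (two hypersurfaces of `ℙᴺ`, `N ≥ 2`, meet, and
the meeting points of the factors are singular). -/
def GenericNonsingular : Prop :=
  ∀ (𝔇 : Datum) (c : ↥𝔇.B → ℂ), AlgebraicIndependent ℚ c →
    Motives.SmoothHypersurface.IsNonsingularForm ℂ (𝔇.form c) ∧
      ∀ (K : Type) [Field K] [Algebra ℂ K],
        Irreducible (MvPolynomial.map (algebraMap ℂ K) (𝔇.form c))

/-- (K2a-iii, L) KAPRANOV'S THEOREM for the perturbed Fermat hypersurface over the (non-discretely)
valued field `(ℂ, v)`, extended to `𝕋ℙ^{2p+1}`: if `v(c_b) = e^{-h_b}` (so `val(c_b) = h_b`,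
`val(1) = 0`) and `v` is non-trivial (hence its value group, divisible as `ℂ` is algebraically
closed, is dense), the closure of the coordinatewise valuation image of `X_c(ℂ)` is the extended
tropical hypersurface of `min_s (ht s + ⟨s, u⟩)`, stratum by stratum of sedentarity (every proper
coordinate stratum keeps a Fermat monomial, so no restriction of the form vanishes identically). -/
def KapranovOnto : Prop :=
  ∀ (𝔇 : Datum) (h : ↥𝔇.B → ℝ) (c : ↥𝔇.B → ℂ) (v : Valuation ℂ NNReal),
    (∀ b, ((v (c b) : NNReal) : ℝ) = Real.exp (-h b)) → (∃ z : ℂ, 1 < v z) →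
      𝔇.tropicalization c v Set.univ = 𝔇.tropicalVariety h

/-- (K2b, L) POLYHEDRAL SHADOWS (Bieri–Groves / structure theorem over a non-discrete value group, and
common refinement). For finitely many Zariski-closed `W_j ⊆ X_c` there is a finite rational polyhedral
structure `Q` of the extended tropical hypersurface `X̄_h = Trop_v(X_c)` (cells with integer normal
vectors and real — possibly irrational — offsets, as `TropCell` allows) in which every `Trop_v(W_j)`
is a union of closed cells. -/
def PolyhedralShadows : Prop :=
  ∀ (𝔇 : Datum) (h : ↥𝔇.B → ℝ) (c : ↥𝔇.B → ℂ) (v : Valuation ℂ NNReal),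
    (∀ b, ((v (c b) : NNReal) : ℝ) = Real.exp (-h b)) → (∃ z : ℂ, 1 < v z) →
    𝔇.tropicalization c v Set.univ = 𝔇.tropicalVariety h →
    ∀ (m : ℕ) (W : Fin m → Set ↥(𝔇.variety c).left), (∀ j, IsClosed (W j)) →
      ∃ Q : Finset (TropCell (2 * 𝔇.p + 2)), IsStructureOf Q (𝔇.tropicalVariety h) ∧
        IsSubcomplexFamily 𝔇 c v Q W

/-- (K2c, XL — THE LOAD-BEARING STUB) CLASS-LEVEL TRANSFER FOR FINITE PRIME FAMILIES. On a generic
realisation (`c` algebraically independent, `X_c` smooth projective of dimension `2p`, `v` trivial on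
`ℚ×`, non-trivial, `v(c_b) = e^{-h_b}`, `Trop_v(X_c) = X̄_h`) at a generic unimodular height, for
irreducible closed `W_j` of codimension `≥ p` with classes `y_j` dying off `W_j` and a structure `Q`
of `X̄_h` in which the `Trop_v(W_j)` are subcomplexes, there are `Q`-adapted tropical `p`-cycles
supported in the `Trop_v(W_j)` whose classes in `H_{p,p}(X̄_h, Q; ℝ)` span at least
`cupRank (span_ℂ (π y_j))`: the multiplicity-weighted shadows `[Trop_v W_j]` are balanced
(Mikhalkin–Zharkov Prop. 4.3) and the tropical cycle class map intertwines the cup product on the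
`A_B`-invariant part with a pairing on tropical homology (Liu; IKMZ) — the open comparison over a
NON-discretely valued `ℂ` named in the crux's "why it might fail". -/
def ClassTransfer : Prop :=
  ∀ (𝔇 : Datum) (h : ↥𝔇.B → ℝ) (c : ↥𝔇.B → ℂ) (v : Valuation ℂ NNReal),
    𝔇.IsGenericHeight h → 𝔇.IsUnimodularHeight h → AlgebraicIndependent ℚ c →
    Motives.IsSmoothProjective (2 * 𝔇.p) (𝔇.variety c) →
    (∀ q : ℚ, q ≠ 0 → v (q : ℂ) = 1) → (∀ b, ((v (c b) : NNReal) : ℝ) = Real.exp (-h b)) →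
    (∃ z : ℂ, 1 < v z) → 𝔇.tropicalization c v Set.univ = 𝔇.tropicalVariety h →
    ∀ (m : ℕ) (W : Fin m → Set ↥(𝔇.variety c).left)
      (y : Fin m → complexBetti (𝔇.variety c) (2 * 𝔇.p)),
      (∀ j, IsClosed (W j) ∧ IsIrreducible (W j) ∧
        ∀ z ∈ W j, ((𝔇.p : ℕ) : ℕ∞) ≤ Order.coheight z) →
      (∀ j, y j ∈ LinearMap.ker (complexBetti.restrictCompl (𝔇.variety c) (W j) (2 * 𝔇.p)).hom) →
      ∀ Q : Finset (TropCell (2 * 𝔇.p + 2)), IsStructureOf Q (𝔇.tropicalVariety h) →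
        IsSubcomplexFamily 𝔇 c v Q W →
        ∃ (κ : Type) (f : κ → Fin m) (C : κ → TropCycle Q 𝔇.p),
          (∀ k, (C k).support ⊆ 𝔇.tropicalization c v (W (f k))) ∧
          cupRank (𝔇.variety c) (2 * 𝔇.p) (Submodule.span ℂ (Set.range fun j ↦ 𝔇.proj c (y j))) ≤
            Module.finrank ℝ ↥(Submodule.span ℝ (Set.range fun k ↦ (C k).cls))

/-- (glue, M) FINITE PRIME FAMILIES SUFFICE. On a smooth projective member `X_c`, if every FINITE
family of classes dying off IRREDUCIBLE closed subsets of codimension `≥ p` has shadows carrying its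
invariant cup rank, then so does every family of classes dying off closed subsets of codimension
`≥ p`: each such class is a finite sum of classes dying off irreducible closed subsets of its support
(`mem_iSup_ker_restrictCompl_irreducible`, Deligne Hodge III Cor. 8.2.8 / Fulton Lemma 19.1.1),
`H^{2p}(X_c(ℂ); ℂ)` is finite-dimensional (`finite_complexBetti`) so finitely many members span
`span (π x)`, `cupRank` is monotone in the subspace (rank of a principal submatrix) and `Trop_v` is
monotone in the subset. -/
def PrimeReduction : Prop :=
  ∀ (𝔇 : Datum) (h : ↥𝔇.B → ℝ) (c : ↥𝔇.B → ℂ) (v : Valuation ℂ NNReal),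
    Motives.IsSmoothProjective (2 * 𝔇.p) (𝔇.variety c) →
    (∀ (m : ℕ) (W : Fin m → Set ↥(𝔇.variety c).left)
        (y : Fin m → complexBetti (𝔇.variety c) (2 * 𝔇.p)),
        (∀ j, IsClosed (W j) ∧ IsIrreducible (W j) ∧
          ∀ z ∈ W j, ((𝔇.p : ℕ) : ℕ∞) ≤ Order.coheight z) →
        (∀ j, y j ∈
          LinearMap.ker (complexBetti.restrictCompl (𝔇.variety c) (W j) (2 * 𝔇.p)).hom) →
        ShadowsCarry 𝔇 h c v (Fin m) W y) →
    ∀ (ι : Type) (Z : ι → Set ↥(𝔇.variety c).left)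
      (x : ι → complexBetti (𝔇.variety c) (2 * 𝔇.p)),
      (∀ a, IsClosed (Z a) ∧ ∀ z ∈ Z a, ((𝔇.p : ℕ) : ℕ∞) ≤ Order.coheight z) →
      (∀ a, x a ∈ LinearMap.ker (complexBetti.restrictCompl (𝔇.variety c) (Z a) (2 * 𝔇.p)).hom) →
      ShadowsCarry 𝔇 h c v ι Z x

/-! ### Stubs (the ONLY `sorry`s of the file) -/

/-- Stub 1 (K2a-i, L): algebraically independent coefficients with a `ℚ`-trivial non-trivial
real valuation of prescribed values. [cite: MaclaganSturmfels2015, §2.1] -/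
theorem stub_heightValuation : HeightValuation := by
  sorry

/-- Stub 2 (K2a-ii, M): generic perturbed Fermat forms are nonsingular and geometrically
irreducible. [cite: Hartshorne1977, I Ex. 5.8 and III Example 10.0.3] -/
theorem stub_genericNonsingular : GenericNonsingular := by
  sorry

/-- Stub 3 (K2a-iii, L): Kapranov's theorem, extended to `𝕋ℙ^{2p+1}`, over the non-discretely
valued `ℂ`. [cite: MaclaganSturmfels2015, Thm. 3.1.3 and §6.2] -/
theorem stub_kapranov : KapranovOnto := by
  sorry

/-- Stub 4 (K2b, L): Bieri–Groves polyhedrality of tropicalisations and a common finite polyhedral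
structure of `X̄_h` carrying them as subcomplexes. [cite: MaclaganSturmfels2015, Thm. 3.3.5 and §6.2]
[cite: AminiPiquerez2020TropicalHC, §2] -/
theorem stub_polyhedralShadows : PolyhedralShadows := by
  sorry

/-- Stub 5 (K2c, XL, hardest): class-level transfer of the invariant cup rank to the tropical shadows
of finite prime families. [cite: MikhalkinZharkov2014Eigenwave, Prop. 4.3]
[cite: Liu2017TropicalCycleClass, arXiv:1702.00047] [cite: IKMZ2016TropicalHomology, arXiv:1604.01838] -/
theorem stub_classTransfer : ClassTransfer := by
  sorry

/-- Stub 6 (glue, M): finite prime families suffice (irreducible decomposition of supports,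
finite-dimensionality, monotonicity of `cupRank` and of `Trop_v`). [cite: Fulton1998, §19.1 Lemma 19.1.1]
[cite: DeligneHodgeIII1974, Cor. 8.2.8] -/
theorem stub_primeReduction : PrimeReduction := by
  sorry

/-! ### Proved here -/

/-- The perturbed Fermat form `Σ xᵢᵈ + Σ_{b ∈ B} c_b x^b` is homogeneous of degree `d` (every
`b ∈ B` has degree `d`). -/
theorem form_isHomogeneous (𝔇 : Datum) (c : ↥𝔇.B → ℂ) : (𝔇.form c).IsHomogeneous 𝔇.d := by
  unfold Datum.form
  refine MvPolynomial.IsHomogeneous.add ?_ ?_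
  · exact MvPolynomial.IsHomogeneous.sum _ _ _ fun i _ ↦ by
      simpa using (MvPolynomial.isHomogeneous_X ℂ i).pow 𝔇.d
  · refine MvPolynomial.IsHomogeneous.sum _ _ _ fun b _ ↦ ?_
    have hb : (b.1).degree = 𝔇.d := by
      rw [Finsupp.degree_eq_sum]
      exact 𝔇.degree_eq b.1 b.2
    have h0 := (MvPolynomial.isHomogeneous_C _ (c b)).mul
      (MvPolynomial.isHomogeneous_monomial (1 : ℂ) hb)
    rwa [zero_add] at h0

/-- `X_c` is smooth projective of dimension `2p` as soon as the form is nonsingular and geometrically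
irreducible (the tree's Jacobian bridge `isSmoothHypersurface_hypersurface`, `d ≥ 3 > 0`). -/
theorem isSmoothProjective_variety (𝔇 : Datum) (c : ↥𝔇.B → ℂ)
    (hJ : Motives.SmoothHypersurface.IsNonsingularForm ℂ (𝔇.form c))
    (hirr : ∀ (K : Type) [Field K] [Algebra ℂ K],
      Irreducible (MvPolynomial.map (algebraMap ℂ K) (𝔇.form c))) :
    Motives.IsSmoothProjective (2 * 𝔇.p) (𝔇.variety c) :=
  (Motives.SmoothHypersurface.isSmoothHypersurface_hypersurface (𝔇.form c) (form_isHomogeneous 𝔇 c)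
    (lt_of_lt_of_le (by norm_num) 𝔇.three_le_d) hJ hirr).1

/-! ### Composition (sorry-free) -/

/-- The implication content, sorry-free: the six pieces give the crux statement VERBATIM — realise
`(c, v)` (stub 1), get smoothness through the Jacobian bridge (stub 2), Kapranov (stub 3), reduce to
finite prime families (stub 6), put their shadows on one structure `Q` (stub 4) and transfer the cup
rank (stub 5). -/
theorem TropicalShadowsCarryRank_of_pieces (h₁ : HeightValuation) (h₂ : GenericNonsingular)
    (h₃ : KapranovOnto) (h₄ : PolyhedralShadows) (h₅ : ClassTransfer) (h₆ : PrimeReduction) :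
    ∀ (𝔇 : Literature.AlgebraicGeometry.HodgeTheory.SparseFermat.Datum) (h : ↥𝔇.B → ℝ), 𝔇.IsGenericHeight h → 𝔇.IsUnimodularHeight h → ∃ (c : ↥𝔇.B → ℂ) (v : Valuation ℂ NNReal), Literature.AlgebraicGeometry.Motives.IsSmoothProjective (2 * 𝔇.p) (𝔇.variety c) ∧ (∀ q : ℚ, q ≠ 0 → v (q : ℂ) = 1) ∧ (∀ b, ((v (c b) : NNReal) : ℝ) = Real.exp (-h b)) ∧ ∀ (ι : Type) (Z : ι → Set ↥(𝔇.variety c).left) (x : ι → Literature.AlgebraicGeometry.HodgeTheory.complexBetti (𝔇.variety c) (2 * 𝔇.p)), (∀ a, IsClosed (Z a) ∧ ∀ z ∈ Z a, ((𝔇.p : ℕ) : ℕ∞) ≤ Order.coheight z) → (∀ a, x a ∈ LinearMap.ker (Literature.AlgebraicGeometry.HodgeTheory.complexBetti.restrictCompl (𝔇.variety c) (Z a) (2 * 𝔇.p)).hom) → ∃ Q : Finset (Literature.AlgebraicGeometry.Tropical.TropCell (2 * 𝔇.p + 2)), Literature.AlgebraicGeometry.Tropical.IsStructureOf Q (𝔇.tropicalVariety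 h) ∧ ∃ (κ : Type) (f : κ → ι) (C : κ → Literature.AlgebraicGeometry.Tropical.TropCycle Q 𝔇.p), (∀ k, (C k).support ⊆ 𝔇.tropicalization c v (Z (f k))) ∧ Literature.AlgebraicGeometry.HodgeTheory.cupRank (𝔇.variety c) (2 * 𝔇.p) (Submodule.span ℂ (Set.range fun a ↦ 𝔇.proj c (x a))) ≤ Module.finrank ℝ ↥(Submodule.span ℝ (Set.range fun k ↦ (C k).cls)) := by
  intro 𝔇 h hgen huni
  obtain ⟨c, v, hci, hvq, hvc, hnt⟩ := h₁ 𝔇 h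
  obtain ⟨hJ, hirr⟩ := h₂ 𝔇 c hci
  have hX : Motives.IsSmoothProjective (2 * 𝔇.p) (𝔇.variety c) :=
    isSmoothProjective_variety 𝔇 c hJ hirr
  have hK : 𝔇.tropicalization c v Set.univ = 𝔇.tropicalVariety h := h₃ 𝔇 h c v hvc hnt
  refine ⟨c, v, hX, hvq, hvc, ?_⟩
  refine h₆ 𝔇 h c v hX ?_
  intro m W y hW hy
  obtain ⟨Q, hQ, hS⟩ := h₄ 𝔇 h c v hvc hnt hK m W fun j ↦ (hW j).1
  obtain ⟨κ, f, C, hsupp, hle⟩ :=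
    h₅ 𝔇 h c v hgen huni hci hX hvq hvc hnt hK m W y hW hy Q hQ hS
  exact ⟨Q, hQ, κ, f, C, hsupp, hle⟩

/-- **THE SKELETON THEOREM.** The crux
`Summit.HodgeConjecture.HodgeConjecture.Theses.SparseFermatTropicalDeficiency.TropicalShadowsCarryRank`,
concluded BY NAME from the six DECLARED stubs (the only `sorry`s of the file) through the sorry-free
composition `TropicalShadowsCarryRank_of_pieces`. -/
theorem TropicalShadowsCarryRank_of :
    Summit.HodgeConjecture.HodgeConjecture.Theses.SparseFermatTropicalDeficiency.TropicalShadowsCarryRank :=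
  TropicalShadowsCarryRank_of_pieces stub_heightValuation stub_genericNonsingular stub_kapranov
    stub_polyhedralShadows stub_classTransfer stub_primeReduction

end Summit.HodgeConjecture.HodgeConjecture.Cruxes.TropicalShadowsCarryRank.Birth

end
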